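import Literature.NumberTheory.EllipticCurves.KubertTateFiveEisensteinTwistMinimalModel
import Literature.NumberTheory.EllipticCurves.KubertTateM37152EisensteinDescent
import Literature.NumberTheory.EllipticCurves.KubertTateM37152ShaFive
import Literature.NumberTheory.EllipticCurves.LocalReductionKrausMinimality
import Literature.NumberTheory.EllipticCurves.ComplexMultiplicationLocalFactorsAux
import Mathlib.Tactic.NormNum.Prime
import HarnessLib

/-!
# The Eisenstein twist `E_{-37/152}^{(-3)}/ℚ`: RANK `2` and `t₅ = 0` by the `5`-descent over `ℚ(ζ₃)`; its minimal model
# `W₆ = [1, −43669, −12, 727222893, −4934118717095]`, `a₅(W₆) = -1` — the SECOND rank-`2` curve at a NON-anomalous Eisenstein prime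

PROOF-ONLY file (theorems only, no definition, no named fact, no `sorry`), topic `NumberTheory/EllipticCurves`: the
`ℚ`-side of the instance `KubertTateM37152EisensteinDescent` (`rank E_{-37/152}(ℚ(ζ₃)) = 4`, `t₅(E_{-37/152} ⊗ ℚ(ζ₃)) = 0`,
box of five places filled by three `ℚ`-points and two genuine `ℚ(ζ₃)`-points), read through
`rank E(ℚ(ζ₃)) = rank E(ℚ) + rank E^{(-3)}(ℚ)` and `t₅(E ⊗ ℚ(ζ₃)) = t₅(E) + t₅(E^{(-3)})` (tree
`mordellWeilRank_baseChange_quadratic_holds`, `selmerCorank_baseChange_quadratic_holds`, `d_{ℚ(ζ₃)} = -3`) and the tree's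
`rank E_{-37/152}(ℚ) = 2` (`KubertTateM37152Descent`):

* §1 `mordellWeilRank_rat_eq_two`, `shaCorank_five_rat_eq_zero` (tree, cast coordinates), **`mordellWeilRank_twist_eq_two`**
  (`rank E_{-37/152}^{(-3)}(ℚ) = 4 − 2 = 2`), **`shaCorank_five_twist_eq_zero`** (`t₅(E_{-37/152}^{(-3)}/ℚ) = 0`), `twist_37_152`.
* §2 the model: `E_{-37/152}^{(-3)} = [0, −174651/4, 0, 727048224, −4932664445952]` (`twist_eq`), `⟨1, 2, −1/2, 5⟩ • W₆ = E^{(-3)}` for the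
  integer model `W₆ = [1, −43669, −12, 727222893, −4934118717095]` (`variableChange_model`), `Δ(W₆) = −2¹⁵·3⁶·19⁵·37⁵·40129`,
  `c₄ = −4395342951` (odd: `2⁴ ∤ c₄`), globally minimal (Kraus, tree `isGloballyMinimal_of_int_kraus`).
* §3 **`cgls_shape_37_152`** — by the class-wide theorem `KubertTateEisensteinTwist.cgls_hypotheses_of_model` (`ω₂(5624) = 2`):
  `Good W₆ 5`, `Red W₆ 5` (a rational `5`-isogeny), `¬ Anom W₆ 5` (`a₅(W₆) = -a₅(E_{-37/152}) ≡ -1 (mod 5)`: `5` is INERT in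
  `ℚ(√-3)`; numerically `a₅(W₆) = -1`), **`corank_{ℤ₅} Sel_{5^∞}(W₆/ℚ) = 2 = rank W₆(ℚ)`**.

What this is (stmt-BirchSwinnertonDyer-22356, «T = FiniteShaComponentTransfer»): the SECOND RANK-TWO door of the route's
Eisenstein-twist instrument (after `KubertTate1314EisensteinTwist`; here the box over `ℚ(ζ₃)` is filled by the twist points themselves) — a rank-`2` elliptic curve over `ℚ` WITHOUT rational `5`-torsion whose `5`-primary Ш has
corank `0` by descent alone, at a good ordinary NON-anomalous Eisenstein prime (the tree's other rank-`2` twist door,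
`KubertTate14613GaussianDescent`, is anomalous at `5`: `a₅ ≡ 1`).  The printed Eisenstein `p`-converse
(Castella–Grossi–Lee–Skinner 2022, Thm. E) stops at corank `r ∈ {0, 1}`; at corank `2` no `p`-converse is in print, so T is
NOT discharged here: `(W₆, 5)` is a certified instance of the open core of T in exactly the shape (`Good ∧ Red ∧ ¬Anom ∧
corank Sel_{5^∞} = 2`) a rank-two Eisenstein converse would consume.  BSD is not proved by this.

## References

* [SilvermanAEC2009] J. H. Silverman, *AEC*, 2nd ed., Thm. X.4.2, Exercise 10.16, VII.1 Remark 1.1, X.§2.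
* [Kraus1989] A. Kraus, Manuscripta Math. 65 (1989), Prop. 2.
* [CastellaGrossiLeeSkinner2022] F. Castella, G. Grossi, J. Lee, C. Skinner, Invent. Math. 227 (2022), Thm. E.
* [Dokchitser2013ParityNotes] T. Dokchitser, Notes on the parity conjecture (2013), §4.
-/

noncomputable section

open scoped Classical
open WeierstrassCurve Literature.NumberTheory.EllipticCurves
open Literature.NumberTheory.EllipticCurves.Rank1Residual.X11RankOneCertificates (discOf c4Of c6Of)
open Literature.NumberTheory.EllipticCurves.Rank1Residual
open Literature.NumberTheory.NumberFields

namespace Literature.NumberTheory.EllipticCurves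

namespace KubertTateM37152EisensteinTwist

/-! ## §1 The twist `E_{-37/152}^{(-3)}`: rank `2` and `t₅ = 0` from the descent over `ℚ(ζ₃)` -/

/-- `rank E_{-37/152}(ℚ) = 2` (tree `KubertTateM37152Descent.mordellWeilRank_eq`). [cite: SilvermanAEC2009, Thm. X.1.1] -/
theorem mordellWeilRank_rat_eq_two :
    haveI := KubertTateM37152Descent.isElliptic
    (kubertTateFive (((-37 : ℤ) : ℚ)) (((152 : ℤ) : ℚ))).mordellWeilRank = 2 :=
  KubertTateM37152Descent.mordellWeilRank_eq

/-- `t₅(E_{-37/152}/ℚ) = 0` (tree `KubertTateM37152Descent.shaCorank_five_eq_zero`). [cite: SilvermanAEC2009, Thm. X.4.2(a)] -/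
theorem shaCorank_five_rat_eq_zero :
    haveI := KubertTateM37152Descent.isElliptic
    haveI : Fact (Nat.Prime 5) := ⟨Nat.prime_five⟩
    (kubertTateFive (((-37 : ℤ) : ℚ)) (((152 : ℤ) : ℚ))).shaCorank 5 = 0 :=
  KubertTateM37152Descent.shaCorank_five_eq_zero

/-- The twist by `-3` is elliptic. [cite: SilvermanAEC2009, X.§2] -/
theorem isElliptic_twist :
    haveI := KubertTateM37152Descent.isElliptic
    ((kubertTateFive (((-37 : ℤ) : ℚ)) (((152 : ℤ) : ℚ))).quadraticTwist (-3)).IsElliptic := by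
  haveI := KubertTateM37152Descent.isElliptic
  exact isElliptic_quadraticTwist _ (by norm_num)

/-- **`rank E_{-37/152}^{(-3)}(ℚ) = 2`, unconditionally**: `rank E(ℚ(ζ₃)) = rank E(ℚ) + rank E^{(-3)}(ℚ)` (`d_{ℚ(ζ₃)} = -3`;
tree `KubertTateEisensteinTwist.mordellWeilRank_base_eq_add_three`) with `4 = 2 + rank E^{(-3)}(ℚ)`
(`KubertTateM37152EisensteinDescent.mordellWeilRank_eq_four`). [cite: SilvermanAEC2009, Exercise 10.16] -/
theorem mordellWeilRank_twist_eq_two :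
    haveI := KubertTateM37152Descent.isElliptic
    haveI := isElliptic_twist
    ((kubertTateFive (((-37 : ℤ) : ℚ)) (((152 : ℤ) : ℚ))).quadraticTwist (-3)).mordellWeilRank = 2 := by
  haveI := KubertTateM37152Descent.isElliptic
  haveI := isElliptic_twist
  have hR := KubertTateEisensteinTwist.mordellWeilRank_base_eq_add_three (-37) 152
  have h4 := KubertTateM37152EisensteinDescent.mordellWeilRank_eq_four
  have h2 := mordellWeilRank_rat_eq_two
  omega

/-- Transport of `t_p` along an equality of curves. [folklore] -/
private theorem shaCorank_congr {F : Type} [Field F] [NumberField F] {V V' : WeierstrassCurve F}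
    [V.IsElliptic] [V'.IsElliptic] (e : V = V') (p : ℕ) [Fact p.Prime] : V.shaCorank p = V'.shaCorank p := by
  subst e; rfl

/-- **`t₅(E_{-37/152}^{(-3)}/ℚ) = 0`, unconditionally** — the door at `5` on a RANK-`2` twist WITHOUT a rational `5`-torsion
point, at a NON-anomalous Eisenstein prime: `t₅(E_K) = t₅(E) + t₅(E^{(d_K)})` (`corank Sel(E_K) = corank Sel(E) + corank Sel(E^{(d_K)})`,
tree `selmerCorank_baseChange_quadratic_holds`; `rank E(K) = rank E + rank E^{(d_K)}`; Greenberg's `corank Sel = rank + t`)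
with `t₅(E_K) = 0` at `K = ℚ(ζ₃)`, `d_K = -3`. [cite: Dokchitser2013ParityNotes, §4] [cite: SilvermanAEC2009, Thm. X.4.2] -/
theorem shaCorank_five_twist_eq_zero :
    haveI := KubertTateM37152Descent.isElliptic
    haveI := isElliptic_twist
    ((kubertTateFive (((-37 : ℤ) : ℚ)) (((152 : ℤ) : ℚ))).quadraticTwist (-3)).shaCorank 5 = 0 := by
  haveI : Fact (Nat.Prime 5) := ⟨Nat.prime_five⟩
  haveI := KubertTateM37152EisensteinDescent.isElliptic
  haveI := KubertTateM37152Descent.isElliptic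
  haveI := isElliptic_twist
  set W := kubertTateFive (((-37 : ℤ) : ℚ)) (((152 : ℤ) : ℚ)) with hW
  haveI hbc : (W.baseChange K3).IsElliptic := by
    rw [hW, KubertTateMuDescentNF.baseChange_eq (K := ℚ) (-37) 152 K3]; exact KubertTateM37152EisensteinDescent.isElliptic
  have hd : ((NumberField.discr K3 : ℤ) : ℚ) ≠ 0 := by exact_mod_cast NumberField.discr_ne_zero K3
  haveI : (W.quadraticTwist (NumberField.discr K3 : ℚ)).IsElliptic := isElliptic_quadraticTwist _ hd
  have hS := selmerCorank_baseChange_quadratic_holds W K3 K3.finrank_eq 5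
  have hR := mordellWeilRank_baseChange_quadratic_holds W K3 K3.finrank_eq
  have hK := (W.baseChange K3).selmerCorank_eq_mordellWeilRank_add_holds 5
  have hQ := W.selmerCorank_eq_mordellWeilRank_add_holds 5
  have hT := (W.quadraticTwist (NumberField.discr K3 : ℚ)).selmerCorank_eq_mordellWeilRank_add_holds 5
  have h0 : (W.baseChange K3).shaCorank 5 = 0 := by
    rw [shaCorank_congr (KubertTateMuDescentNF.baseChange_eq (K := ℚ) (-37) 152 K3) 5]
    exact KubertTateM37152EisensteinDescent.shaCorank_five_eq_zero
  have h3 : ((NumberField.discr K3 : ℤ) : ℚ) = -3 := by rw [KubertTateEisensteinTwist.discr_K3]; norm_num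
  rw [h3] at hS hR hT
  omega

/-- **Both components at once**: `rank E_{-37/152}^{(-3)}(ℚ) = 2` and `t₅(E_{-37/152}^{(-3)}/ℚ) = 0`, together with
`rank E_{-37/152}(ℚ) = 2` and `t₅(E_{-37/152}/ℚ) = 0` (tree) — the complete cross-field picture `rank E(ℚ(ζ₃)) = 2 + 2`,
`t₅(E ⊗ ℚ(ζ₃)) = 0 + 0`. [cite: SilvermanAEC2009, Thm. X.4.2 and Exercise 10.16] -/
theorem twist_37_152 :
    haveI := KubertTateM37152Descent.isElliptic
    haveI := isElliptic_twist
    ((kubertTateFive (((-37 : ℤ) : ℚ)) (((152 : ℤ) : ℚ))).quadraticTwist (-3)).mordellWeilRank = 2 ∧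
      ((kubertTateFive (((-37 : ℤ) : ℚ)) (((152 : ℤ) : ℚ))).quadraticTwist (-3)).shaCorank 5 = 0 ∧
      (kubertTateFive (((-37 : ℤ) : ℚ)) (((152 : ℤ) : ℚ))).mordellWeilRank = 2 ∧
      (kubertTateFive (((-37 : ℤ) : ℚ)) (((152 : ℤ) : ℚ))).shaCorank 5 = 0 :=
  ⟨mordellWeilRank_twist_eq_two, shaCorank_five_twist_eq_zero, mordellWeilRank_rat_eq_two, shaCorank_five_rat_eq_zero⟩

/-! ## §2 The minimal model `W₆ = [1, −43669, −12, 727222893, −4934118717095]` of the twist -/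

/-- **`E_{-37/152}^{(-3)} = [0, −174651/4, 0, 727048224, −4932664445952]`** (`b₂ = 58217`, `b₄ = 161566272`, `b₆ = 730765103104`). [cite: SilvermanAEC2009, X.§2] -/
theorem twist_eq : (kubertTateFive (((-37 : ℤ) : ℚ)) (((152 : ℤ) : ℚ))).quadraticTwist (-3) =
    (⟨0, -174651 / 4, 0, 727048224, -4932664445952⟩ : WeierstrassCurve ℚ) := by
  rw [KubertTateM37152Descent.curve_eq]
  ext <;> simp [quadraticTwist, WeierstrassCurve.b₂, WeierstrassCurve.b₄, WeierstrassCurve.b₆] <;> norm_num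

/-- **`⟨1, 2, −1/2, 5⟩ • W₆ = E_{-37/152}^{(-3)}`** for the integer model `W₆ = [1, −43669, −12, 727222893, −4934118717095]`.
[cite: SilvermanAEC2009, III.1 Table 3.1] -/
theorem variableChange_model :
    (⟨1, 2, -1 / 2, 5⟩ : VariableChange ℚ) •
        (⟨((1 : ℤ) : ℚ), ((-43669 : ℤ) : ℚ), ((-12 : ℤ) : ℚ), ((727222893 : ℤ) : ℚ), ((-4934118717095 : ℤ) : ℚ)⟩ : WeierstrassCurve ℚ) =
      (kubertTateFive (((-37 : ℤ) : ℚ)) (((152 : ℤ) : ℚ))).quadraticTwist (-3) := by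
  rw [twist_eq]
  ext <;> simp [variableChange_a₁, variableChange_a₂, variableChange_a₃, variableChange_a₄, variableChange_a₆] <;> norm_num

/-- The model `W₆` is elliptic. [cite: SilvermanAEC2009, X.§2] -/
theorem isElliptic_model :
    (⟨((1 : ℤ) : ℚ), ((-43669 : ℤ) : ℚ), ((-12 : ℤ) : ℚ), ((727222893 : ℤ) : ℚ), ((-4934118717095 : ℤ) : ℚ)⟩ : WeierstrassCurve ℚ).IsElliptic := by
  refine ⟨isUnit_iff_ne_zero.mpr ?_⟩
  norm_num [WeierstrassCurve.Δ, WeierstrassCurve.b₂, WeierstrassCurve.b₄, WeierstrassCurve.b₆, WeierstrassCurve.b₈]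

/-- `Δ`, `c₄` of the integer model (kernel evaluation): `Δ(W₆) = −2¹⁵·3⁶·19⁵·37⁵·40129`, `c₄ = −4395342951`. [folklore] -/
private theorem invariants_model :
    discOf [1, -43669, -12, 727222893, -4934118717095] = -164593403507095098342211584 ∧ c4Of [1, -43669, -12, 727222893, -4934118717095] = -4395342951 := by
  refine ⟨?_, ?_⟩ <;> decide

/-- **`W₆` is globally minimal**: `2¹⁵ ∣ Δ(W₆)` but `2⁴ ∤ c₄` (odd), and no other prime to the twelfth power. [cite: SilvermanAEC2009, VII.1 Remark 1.1]
[cite: Kraus1989, Prop. 2] -/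
theorem isGloballyMinimal_model :
    (⟨((1 : ℤ) : ℚ), ((-43669 : ℤ) : ℚ), ((-12 : ℤ) : ℚ), ((727222893 : ℤ) : ℚ), ((-4934118717095 : ℤ) : ℚ)⟩ :
      WeierstrassCurve ℚ).IsGloballyMinimal := by
  obtain ⟨hD, hc4⟩ := invariants_model
  refine WeierstrassCurve.isGloballyMinimal_of_int_kraus 1 (-43669) (-12) 727222893 (-4934118717095) fun q hq ↦ Or.inl fun h ↦ ?_
  obtain ⟨h12, h4⟩ := h
  rw [hD] at h12
  rw [hc4] at h4
  have hq1 : (q : ℤ) ∣ 164593403507095098342211584 := Int.dvd_neg.mp (dvd_trans (dvd_pow_self _ (by norm_num)) h12)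
  have hdvdN : q ∣ 2 ^ 15 * 3 ^ 6 * 19 ^ 5 * 37 ^ 5 * 40129 := by
    have e : ((2 ^ 15 * 3 ^ 6 * 19 ^ 5 * 37 ^ 5 * 40129 : ℕ) : ℤ) = 164593403507095098342211584 := by norm_num
    exact Int.natCast_dvd_natCast.mp (e ▸ hq1)
  have hpi := Nat.Prime.prime hq
  rcases hpi.dvd_or_dvd hdvdN with h | h
  · rcases hpi.dvd_or_dvd h with h | h
    · rcases hpi.dvd_or_dvd h with h | h
      · rcases hpi.dvd_or_dvd h with h | h
        · have := (Nat.prime_dvd_prime_iff_eq hq Nat.prime_two).mp (hpi.dvd_of_dvd_pow h)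
          subst this; revert h4; norm_num
        · have := (Nat.prime_dvd_prime_iff_eq hq Nat.prime_three).mp (hpi.dvd_of_dvd_pow h)
          subst this; revert h12; norm_num
      · have := (Nat.prime_dvd_prime_iff_eq hq (by norm_num : Nat.Prime 19)).mp (hpi.dvd_of_dvd_pow h)
        subst this; revert h12; norm_num
    · have := (Nat.prime_dvd_prime_iff_eq hq (by norm_num : Nat.Prime 37)).mp (hpi.dvd_of_dvd_pow h)
      subst this; revert h12; norm_num
  · have := (Nat.prime_dvd_prime_iff_eq hq (by norm_num : Nat.Prime 40129)).mp h
    subst this; revert h12; norm_num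

/-- `rank W₆(ℚ) = 2` (isomorphism invariance; `rank E_{-37/152}^{(-3)}(ℚ) = 2`). [cite: SilvermanAEC2009, VIII.§1] -/
theorem mordellWeilRank_model :
    haveI := isElliptic_model
    (⟨((1 : ℤ) : ℚ), ((-43669 : ℤ) : ℚ), ((-12 : ℤ) : ℚ), ((727222893 : ℤ) : ℚ), ((-4934118717095 : ℤ) : ℚ)⟩ : WeierstrassCurve ℚ).mordellWeilRank = 2 := by
  haveI := KubertTateM37152Descent.isElliptic
  haveI := isElliptic_twist
  haveI := isElliptic_model
  rw [KubertTateEisensteinTwist.mordellWeilRank_of_model (-37) 152 _ _ variableChange_model]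
  exact mordellWeilRank_twist_eq_two

/-! ## §3 The shape of a rank-two Eisenstein converse at `(W₆, 5)` — by the class-wide theorems -/

/-- `13` and `14` are coprime. [folklore] -/
private theorem isCoprime : IsCoprime (-37 : ℤ) 152 := Int.isCoprime_iff_gcd_eq_one.mpr (by norm_num)

/-- `ω(5624) = 3` and `ω₂(5624) = 2` (`5624 = 2³·19·37`, `19, 37 ≡ 1 (mod 3)`). [folklore] -/
private theorem card_primeFactors :
    (((-37 : ℤ) * 152).natAbs.primeFactors).card = 3 ∧ ((((-37 : ℤ) * 152).natAbs.primeFactors.filter (fun ℓ ↦ ℓ % 3 = 1))).card = 2 := by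
  have e : ((-37 : ℤ) * 152).natAbs = 2 ^ 3 * 19 * 37 := by norm_num
  rw [e, Nat.primeFactors_mul (by norm_num) (by norm_num), Nat.primeFactors_mul (by norm_num) (by norm_num),
    Nat.primeFactors_prime_pow (by norm_num) Nat.prime_two, Nat.Prime.primeFactors (by norm_num : Nat.Prime 19),
    Nat.Prime.primeFactors (by norm_num : Nat.Prime 37)]
  exact ⟨by decide, by decide⟩

/-- **THE SHAPE OF A RANK-TWO EISENSTEIN CONVERSE AT `(W₆, 5)`, from the class-wide theorem
`KubertTateEisensteinTwist.cgls_hypotheses_of_model`** (`ω₂(5624) = 2 ≤ rank E^{(-3)}(ℚ) = 2`; reference point `P₁ = (-830, 4700)`,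
good prime `3`): `Good W₆ 5`, `Red W₆ 5`, `¬ Anom W₆ 5` (`a₅(W₆) = -a₅(E_{-37/152}) ≡ -1 (mod 5)`), **`corank_{ℤ₅} Sel_{5^∞}(W₆/ℚ) = 2`** and
`rank W₆(ℚ) = 2`.  The printed converse (CGLS Thm. E) covers `r ∈ {0, 1}` only: at `r = 2` this is a certified instance of
the OPEN core of T, not a discharge. [cite: CastellaGrossiLeeSkinner2022, Thm. E (r ∈ {0,1}; here r = 2 is outside)]
[cite: SilvermanAEC2009, Exercise 10.16] -/
theorem cgls_shape_37_152 :
    haveI := isGloballyMinimal_model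
    haveI := isElliptic_model
    haveI : Fact (Nat.Prime 5) := ⟨Nat.prime_five⟩
    Good (⟨((1 : ℤ) : ℚ), ((-43669 : ℤ) : ℚ), ((-12 : ℤ) : ℚ), ((727222893 : ℤ) : ℚ), ((-4934118717095 : ℤ) : ℚ)⟩ : WeierstrassCurve ℚ) 5 ∧
      Red (⟨((1 : ℤ) : ℚ), ((-43669 : ℤ) : ℚ), ((-12 : ℤ) : ℚ), ((727222893 : ℤ) : ℚ), ((-4934118717095 : ℤ) : ℚ)⟩ : WeierstrassCurve ℚ) 5 ∧
      ¬ Anom (⟨((1 : ℤ) : ℚ), ((-43669 : ℤ) : ℚ), ((-12 : ℤ) : ℚ), ((727222893 : ℤ) : ℚ), ((-4934118717095 : ℤ) : ℚ)⟩ : WeierstrassCurve ℚ) 5 ∧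
      (⟨((1 : ℤ) : ℚ), ((-43669 : ℤ) : ℚ), ((-12 : ℤ) : ℚ), ((727222893 : ℤ) : ℚ), ((-4934118717095 : ℤ) : ℚ)⟩ : WeierstrassCurve ℚ).selmerCorank 5 = 2 ∧
      (⟨((1 : ℤ) : ℚ), ((-43669 : ℤ) : ℚ), ((-12 : ℤ) : ℚ), ((727222893 : ℤ) : ℚ), ((-4934118717095 : ℤ) : ℚ)⟩ : WeierstrassCurve ℚ).mordellWeilRank = 2 := by
  haveI := KubertTateM37152Descent.isElliptic
  haveI := isElliptic_twist
  haveI := isElliptic_model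
  haveI := isGloballyMinimal_model
  haveI : Fact (Nat.Prime 5) := ⟨Nat.prime_five⟩
  haveI : Fact (Nat.Prime 3) := ⟨Nat.prime_three⟩
  have hP : (kubertTateFive (((-37 : ℤ) : ℚ)) (((152 : ℤ) : ℚ))).toAffine.Nonsingular (-830) 4700 :=
    KubertTateM37152EisensteinDescent.nonsingular_P₁_rat
  obtain ⟨hω, hω₂⟩ := card_primeFactors
  have hr : ((-37 : ℤ) * 152).natAbs.primeFactors.card ≤ (kubertTateFive (((-37 : ℤ) : ℚ)) (((152 : ℤ) : ℚ))).mordellWeilRank + 1 := by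
    rw [hω, mordellWeilRank_rat_eq_two]
  have hr' : (((-37 : ℤ) * 152).natAbs.primeFactors.filter (fun ℓ ↦ ℓ % 3 = 1)).card ≤
      ((kubertTateFive (((-37 : ℤ) : ℚ)) (((152 : ℤ) : ℚ))).quadraticTwist (-3)).mordellWeilRank := by
    rw [hω₂, mordellWeilRank_twist_eq_two]
  have h := KubertTateEisensteinTwist.cgls_hypotheses_of_model (-37) 152 isCoprime KubertTateM37152Descent.not_five_dvd_Δ KubertTateM37152EisensteinDescent.eisenstein_tame hP
    (by norm_num) (by norm_num) 3 (by norm_num) (by norm_num) KubertTateM37152Descent.not_tor_dvd_Δ hr hr' _ _ variableChange_model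
  rw [hω₂] at h
  exact h

end KubertTateM37152EisensteinTwist

end Literature.NumberTheory.EllipticCurves

end
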